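import Summits.CriticalPhenomena.SAWScalingLimit.Theorems.SAWPoissonBanksBanksOfLimit
import Summits.CriticalPhenomena.SAWScalingLimit.Theses.SAWConfRestriction

/-!
# `SAWPoissonBanks.BanksOfLimit` (stmt-CriticalPhenomena-4778) under HULL restriction

Companion of `SAWPoissonBanksBanksOfLimit.lean` (same item, same proof): the passage of the
alternation tower of `PoissonianBanks` to a chordal scaling-limit family `P`, with the restriction
hypothesis weakened from the tree's `ChordalFamily.IsRestriction` (ALL sub-domains with the same
marked points, including those pinching at `a` or `b`) to `ChordalFamily.IsHullRestriction`
(restriction over hull subdomains only: `D ∖ D'` bounded away from `a` and `b` — Lawler–Schramm–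
Werner's actual hypothesis `A ∈ 𝒬*`, [LSW03] §2 p. 9). The proof of
`banksOfLimit_of_restriction` conditions only on the base `B` and the hull complements `F_i`,
which agree with `D` in balls at the marked points and hence ARE hull subdomains
(`isHullSubdomain_of_ball_eq`), so the weaker hypothesis suffices verbatim
(`banksOfLimit_of_hullRestriction`). Recorded because the refuter notes on the sibling item
stmt-CriticalPhenomena-0773 question `IsRestriction` for pinching sub-domains, so a planner
restating `BanksOfLimit` / `AxiomsOfLimit` may prefer the hull form. Also recorded: the two extra
hypotheses are verbatim the conclusions of the cruxes `RestrictionOfLimit`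
(stmt-CriticalPhenomena-0773) and `SimpleOfLimit` (stmt-CriticalPhenomena-0774) of route
`SAWConfRestriction`, whence `BanksOfLimit_of_restrictionOfLimit_of_simpleOfLimit`.

## References

* G. F. Lawler, O. Schramm, W. Werner, *Conformal restriction: the chordal case*, J. Amer. Math.
  Soc. 16 (2003), §2 p. 9 and Prop. 3.3 (1).
* P. Billingsley, *Convergence of probability measures*, 2nd ed. (1999), Thm. 2.1.
-/

noncomputable section

open MeasureTheory Filter Topology Set Metric
open scoped ENNReal NNReal BoundedContinuousFunction
open Literature.Probability.LatticeModels Literature.Probability.RandomPlanarGeometry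
  Literature.Probability.RandomPlanarGeometry.SAW
open Summit.CriticalPhenomena.SAWScalingLimit.Theses.SAWPoissonBanks

namespace Summit.CriticalPhenomena.SAWScalingLimit.Theorems

namespace SAWPoissonBanksBanksOfLimit

/-! ### Hull subdomains; null touching from hull restriction; the tower -/

/-- The ε-ball agreement clause makes an admissible sub-domain a hull subdomain
(`MarkedDomain.IsHullSubdomain`: the removed part stays away from both marked points). [folklore] -/
theorem isHullSubdomain_of_ball_eq {D D' : DobrushinDomain} (hsub : D'.carrier ⊆ D.carrier)
    (h0 : D'.pt 0 = D.pt 0) (h1 : D'.pt 1 = D.pt 1) {ε : ℝ} (hε : 0 < ε)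
    (hb0 : D'.carrier ∩ ball (D.pt 0) ε = D.carrier ∩ ball (D.pt 0) ε)
    (hb1 : D'.carrier ∩ ball (D.pt 1) ε = D.carrier ∩ ball (D.pt 1) ε) :
    D.IsHullSubdomain D' := by
  have key : ∀ p : ℂ, D'.carrier ∩ ball p ε = D.carrier ∩ ball p ε →
      p ∉ closure (D.carrier \ D'.carrier) := by
    intro p hp hcl
    rw [Metric.mem_closure_iff] at hcl
    obtain ⟨z, ⟨hzD, hzD'⟩, hdist⟩ := hcl ε hε
    have hz : z ∈ D.carrier ∩ ball p ε := ⟨hzD, by rwa [mem_ball, dist_comm]⟩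
    rw [← hp] at hz
    exact hzD' hz.1
  exact ⟨hsub, h0, h1, key _ hb0, key _ hb1⟩

/-- **Null touching from HULL restriction.** As `measure_rangeSubset_inter_touch_eq_zero`, with the
restriction identity assumed only over hull subdomains (`ChordalFamily.IsHullRestriction`, LSW's
`𝒜₁`-covariance for `A ∈ 𝒬*` — the paper's hypothesis, weaker than `IsRestriction`).
[cite: LawlerSchrammWerner2003Restriction, §2 p. 9 and Prop. 3.3 (1)] -/
theorem measure_rangeSubset_inter_touch_eq_zero_of_isHullRestriction {P : ChordalFamily}
    (hR : P.IsHullRestriction) {D D' : DobrushinDomain} (hD' : D.IsHullSubdomain D')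
    (hbdry : ∀ᵐ γ ∂(P D'), γ.range ∩ frontier D'.carrier ⊆ {D'.pt 0, D'.pt 1}) :
    P D (CurveClass.rangeSubset (closure D'.carrier) ∩
      {c : CurveClass ℂ | ¬ (c.range ∩ frontier D'.carrier ⊆ {D'.pt 0, D'.pt 1})}) = 0 := by
  have h := hR D D' hD' _ (measurableSet_touch D')
  have h0' : P D' {c : CurveClass ℂ | ¬ (c.range ∩ frontier D'.carrier ⊆ {D'.pt 0, D'.pt 1})} =
      0 := ae_iff.1 hbdry
  rw [h0', zero_mul] at h
  rw [inter_comm]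
  exact h.symm

/-- **`BanksOfLimit` under HULL restriction and boundary avoidance** — the same statement as
`banksOfLimit_of_restriction` with `P.IsRestriction` weakened to `P.IsHullRestriction`
(restriction over hull subdomains only, [LSW]'s actual hypothesis): the proof conditions only on the
base `B` and the hull complements `F_i`, which ARE hull subdomains of `D`
(`isHullSubdomain_of_ball_eq`). [cite: BillingsleyCPM1999, Thm. 2.1] -/
theorem banksOfLimit_of_hullRestriction (hPB : PoissonianBanks) (P : ChordalFamily)
    (hP : P.IsChordal)
    (hlim : ∀ (D : DobrushinDomain) (a b : ℝ → Site 2), IsEndpointApprox D a b →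
      TendstoLaw (fun δ (γ : DomainSAW D.carrier δ (a δ) (b δ)) => γ.curve)
        (fun δ => law D.carrier δ (a δ) (b δ)) id (P D))
    (hR : P.IsHullRestriction)
    (hbdry : ∀ D : DobrushinDomain, ∀ᵐ γ ∂(P D), γ.range ∩ frontier D.carrier ⊆ {D.pt 0, D.pt 1})
    (D : DobrushinDomain) (j : Fin 2) (B : DobrushinDomain) (n : ℕ)
    (F : Fin (n + 1) → DobrushinDomain)
    (hB : B.carrier ⊆ D.carrier ∧ B.pt 0 = D.pt 0 ∧ B.pt 1 = D.pt 1 ∧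
      D.arc j ⊆ frontier B.carrier ∧ (∃ ε : ℝ, 0 < ε ∧
        B.carrier ∩ Metric.ball (D.pt 0) ε = D.carrier ∩ Metric.ball (D.pt 0) ε ∧
        B.carrier ∩ Metric.ball (D.pt 1) ε = D.carrier ∩ Metric.ball (D.pt 1) ε))
    (hF : ∀ i, ((F i).carrier ⊆ D.carrier ∧ (F i).pt 0 = D.pt 0 ∧ (F i).pt 1 = D.pt 1 ∧
      D.arc j ⊆ frontier (F i).carrier ∧ (∃ ε : ℝ, 0 < ε ∧
        (F i).carrier ∩ Metric.ball (D.pt 0) ε = D.carrier ∩ Metric.ball (D.pt 0) ε ∧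
        (F i).carrier ∩ Metric.ball (D.pt 1) ε = D.carrier ∩ Metric.ball (D.pt 1) ε))) :
    (∏ S ∈ (Finset.univ : Finset (Finset (Fin (n + 1)))).filter (fun S => Odd S.card),
      P D (CurveClass.rangeSubset (closure B.carrier) ∩
        ⋂ i ∈ S, CurveClass.rangeSubset (closure (F i).carrier))) ≤
    (∏ S ∈ (Finset.univ : Finset (Finset (Fin (n + 1)))).filter (fun S => Even S.card),
      P D (CurveClass.rangeSubset (closure B.carrier) ∩
        ⋂ i ∈ S, CurveClass.rangeSubset (closure (F i).carrier))) := by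
  obtain ⟨a, b, hab⟩ := exists_isEndpointApprox D
  haveI : IsProbabilityMeasure (P D) := (hP D).1
  obtain ⟨hBsub, hB0, hB1, hBarc, εB, hεB, hεB0, hεB1⟩ := hB
  choose hFsub hF0 hF1 hFarc εF hεF hεF0 hεF1 using hF
  have hBhull : D.IsHullSubdomain B := isHullSubdomain_of_ball_eq hBsub hB0 hB1 hεB hεB0 hεB1
  have hFhull : ∀ i, D.IsHullSubdomain (F i) := fun i =>
    isHullSubdomain_of_ball_eq (hFsub i) (hF0 i) (hF1 i) (hεF i) (hεF0 i) (hεF1 i)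
  set C : Finset (Fin (n + 1)) → Set (CurveClass ℂ) := fun S =>
    CurveClass.rangeSubset (closure B.carrier) ∩
      ⋂ i ∈ S, CurveClass.rangeSubset (closure (F i).carrier) with hC_def
  have hconv : ∀ S : Finset (Fin (n + 1)),
      Tendsto (fun δ => ((law D.carrier δ (a δ) (b δ)).map (fun γ => γ.curve)) (C S))
        (𝓝[>] (0 : ℝ)) (𝓝 (P D (C S))) := by
    intro S
    have hCclosed : IsClosed (C S) :=
      (CurveClass.isClosed_rangeSubset isClosed_closure).inter
        (isClosed_iInter fun i => isClosed_iInter fun _ =>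
          CurveClass.isClosed_rangeSubset isClosed_closure)
    set V : Set ℂ := (B.carrier ∪ ball (D.pt 0) εB ∪ ball (D.pt 1) εB) ∩
      ⋂ i ∈ S, ((F i).carrier ∪ ball (D.pt 0) (εF i) ∪ ball (D.pt 1) (εF i)) with hV_def
    have hVopen : IsOpen V :=
      ((B.isOpen.union isOpen_ball).union isOpen_ball).inter
        (isOpen_biInter_finset fun i _ => ((F i).isOpen.union isOpen_ball).union isOpen_ball)
    refine tendsto_map_law_of_null hab (hlim D a b hab) hCclosed hVopen ?_ ?_
    · intro c hcD hcV
      refine ⟨fun z hz => mem_closure_of_mem_collar hεB0 hεB1 (hcD hz) (hcV hz).1, ?_⟩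
      simp only [mem_iInter, CurveClass.mem_rangeSubset]
      intro i hi z hz
      exact mem_closure_of_mem_collar (hεF0 i) (hεF1 i) (hcD hz) ((mem_iInter₂.1 (hcV hz).2) i hi)
    · have hsub : C S \ CurveClass.rangeSubset V ⊆
          (CurveClass.rangeSubset (closure B.carrier) ∩
            {c : CurveClass ℂ | ¬ (c.range ∩ frontier B.carrier ⊆ {B.pt 0, B.pt 1})}) ∪
            ⋃ i : Fin (n + 1), (CurveClass.rangeSubset (closure (F i).carrier) ∩
              {c : CurveClass ℂ |
                ¬ (c.range ∩ frontier (F i).carrier ⊆ {(F i).pt 0, (F i).pt 1})}) := by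
        rintro c ⟨hcC, hcV⟩
        simp only [CurveClass.mem_rangeSubset, not_subset] at hcV
        obtain ⟨z, hz, hzV⟩ := hcV
        have hcB : c.range ⊆ closure B.carrier := hcC.1
        have hcF : ∀ i ∈ S, c.range ⊆ closure (F i).carrier := fun i hi =>
          (mem_iInter₂.1 hcC.2) i hi
        simp only [hV_def, mem_inter_iff, mem_iInter, not_and_or, not_forall] at hzV
        rcases hzV with hzB | ⟨i, hi, hzF⟩
        · refine Or.inl ⟨hcB, ?_⟩
          obtain ⟨hfr, hne⟩ := mem_frontier_of_not_mem_collar hεB hB0 hB1 (hcB hz) hzB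
          exact fun h => hne (h ⟨hz, hfr⟩)
        · refine Or.inr (mem_iUnion.2 ⟨i, hcF i hi, ?_⟩)
          obtain ⟨hfr, hne⟩ :=
            mem_frontier_of_not_mem_collar (hεF i) (hF0 i) (hF1 i) (hcF i hi hz) hzF
          exact fun h => hne (h ⟨hz, hfr⟩)
      refine measure_mono_null hsub (measure_union_null ?_ ?_)
      · exact measure_rangeSubset_inter_touch_eq_zero_of_isHullRestriction hR hBhull (hbdry B)
      · exact (measure_iUnion_null_iff.2 fun i =>
          measure_rangeSubset_inter_touch_eq_zero_of_isHullRestriction hR (hFhull i)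
            (hbdry (F i)))
  have hprod : ∀ T : Finset (Finset (Fin (n + 1))),
      Tendsto (fun δ => ∏ S ∈ T, ((law D.carrier δ (a δ) (b δ)).map (fun γ => γ.curve)) (C S))
        (𝓝[>] (0 : ℝ)) (𝓝 (∏ S ∈ T, P D (C S))) := fun T =>
    ENNReal.tendsto_finsetProd_of_ne_top T (fun S _ => hconv S) fun S _ => measure_ne_top _ _
  refine ENNReal.le_of_forall_pos_le_add fun ε hε _ => ?_
  have hev := hPB D a b hab j B n F ⟨hBsub, hB0, hB1, hBarc, εB, hεB, hεB0, hεB1⟩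
    (fun i => ⟨hFsub i, hF0 i, hF1 i, hFarc i, εF i, hεF i, hεF0 i, hεF1 i⟩) ε
    (ENNReal.coe_pos.2 hε)
  exact le_of_tendsto_of_tendsto (hprod _) ((hprod _).add tendsto_const_nhds) hev

/-- **`RestrictionOfLimit → SimpleOfLimit → BanksOfLimit`.** The cruxes `RestrictionOfLimit`
(stmt-CriticalPhenomena-0773: the scaling-limit family has the restriction property) and
`SimpleOfLimit` (stmt-CriticalPhenomena-0774: it is carried by simple boundary-avoiding curves) of
route `SAWConfRestriction` supply the two extra hypotheses of
`banksOfLimit_of_hullRestriction` (`IsRestriction` implies `IsHullRestriction`), so they too imply the support item `BanksOfLimit` of route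
`SAWPoissonBanks`. [cite: BillingsleyCPM1999, Thm. 2.1] -/
theorem BanksOfLimit_of_restrictionOfLimit_of_simpleOfLimit
    (hR : Summit.CriticalPhenomena.SAWScalingLimit.Theses.SAWConfRestriction.RestrictionOfLimit)
    (hS : Summit.CriticalPhenomena.SAWScalingLimit.Theses.SAWConfRestriction.SimpleOfLimit) :
    BanksOfLimit := by
  unfold BanksOfLimit
  intro hPB P hP hlim D j B n F hB hF
  exact banksOfLimit_of_hullRestriction hPB P hP hlim
    (show P.IsRestriction from hR P hP hlim).isHullRestriction
    (fun D' => (hS P hP hlim D').mono fun γ h => h.2) D j B n F hB hF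

end SAWPoissonBanksBanksOfLimit

end Summit.CriticalPhenomena.SAWScalingLimit.Theorems

end
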